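import Summits.HodgeConjecture.HodgeConjecture.Theorems.NikulinTwinTransportTwinSimilitudeAlgebraicHKNamedFacts
import HarnessLib

/-!
# Route NikulinTwinTransport · crux X = `TwinSimilitudeAlgebraic` (stmt-HodgeConjecture-13674) —
# the transport crux `TwinTwistorTransport` (stmt-HodgeConjecture-14393) HOLDS ON THE HK-NIKULIN SECTOR
# (line `hyperkaehler-nikulin-anchors`, lead c4)

The line `hyperkaehler-nikulin-anchors` landed, for every projective K3 surface `S` in the HK-Nikulin
sector (`InHKNikulinSector S`: `T(S)_ℚ ↪ (U³ ⊕ E₈(−2) ⊕ ⟨−2⟩)_ℚ` isometrically), an algebraic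
OUT-anchor `2`-similitude `Ψ₀ : H²(S) ⥲ H²(Σ)` into some projective K3 surface `Σ`
(`outAnchor_onHKSector`, p118113), and the transpose calculus making `Ψ₀⁻¹` algebraic
(`stub_inverseAnchorAlgebraic`, `stub_anchorForward`, p119852 / p119877).  This file records the
consequence for the route's TRANSPORT crux `TwinTwistorTransport` (stmt-HodgeConjecture-14393: every
projective K3 `S` has a projective K3 partner `S″` and an ALGEBRAIC `Ψ : H²(S″) ≃ H²(S)` whose inverse is
rational, type-preserving and halves the cup form):

* `anchorData_of_outAnchor` — an out-anchor at `S` with partner `Σ` IS the transport datum at `S` with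
  partner `S″ := Σ`: take `Ψ := 2 · Ψ₀⁻¹` (algebraic: inverse of the anchor, times `2`); its inverse
  `½ · Ψ₀` is rational, type-preserving and halves the form (`Ψ₀` doubles it).  No Buskin, no
  composition of correspondences.
* `twinTwistorTransport_onHKSector` — **`TwinTwistorTransport` at every `S` in the HK-Nikulin sector**,
  granted the named facts (markings, F1–F4), `CupProductAlgebraic` (14350) and the two `(1,1)` items;
  `twinTwistorTransport_onHKSector_of_namedFacts` — the same from named published facts only
  (Voisin I 11.32 ⊗ ℂ for 14350, `AlgebraicClassesOneOneK3` by its proof) plus `LefschetzOneOneK3` (13678).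
* `twinTwistorTransport_of_offHKSectorTransport` — hence the transport crux 14393 REDUCES to K3 surfaces
  OFF the sector (rank `T ≥ 15`, i.e. `ρ ≤ 7`, and the Hasse-obstructed rational types of rank 13/14):
  together with `twinSimilitudeAlgebraic_of_namedFacts_offHKSectorPairs` (p121306) and the landed
  `twinTwistorTransport_of_twinSimilitudeAlgebraic` / `TwinAnchorGlue`, the cruxes X (13674) and 14393 have
  ONE common open core: an algebraic `2`-anchor at a projective K3 surface off the sector.
* `hkTwistorTransportOnSector_anchor` — registered anchor (closed form of the reduction).

No definitions, no new named facts, no `sorry`.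

## References

* [Varesco2023] M. Varesco, Math. Z. 305 (2023), §2 (proof of Thm. 2.1), Thm. 2.1 and Prop. 2.5.
* [CamereEtAl2026] C. Camere, A. Garbagnati, G. Kapustka, M. Kapustka, arXiv:2607.00130, Thm. 1.2, Thm. 5.12.
* [Markman2024] E. Markman, Compos. Math. 160 (2024), Thm. 1.1.
* [VoisinHodgeI2002] C. Voisin, Hodge Theory and Complex Algebraic Geometry I, CUP 2002, Thm. 11.32.
* [VanGeemenSchuett2023] B. van Geemen, M. Schütt, arXiv:2310.05196, Thm. 3.10 and Rem. 4.9.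
-/

noncomputable section

set_option linter.dupNamespace false

open CategoryTheory MonoidalCategory
open scoped Manifold Matrix
open Literature.AlgebraicGeometry.Motives Literature.AlgebraicGeometry.HodgeTheory
open Literature.AlgebraicGeometry.Surfaces Literature.AlgebraicGeometry.Hyperkaehler Literature.Geometry.Kaehler
open Literature.AlgebraicTopology.SingularHomology
open Summit.HodgeConjecture.HodgeConjecture.Theses.NikulinTwinTransport

namespace Summit.HodgeConjecture.HodgeConjecture.Theorems.NikulinTwinTransport

/-! ## Local notations (verbatim those of the route's Theorems files) -/

/-- `Gen[S, p]`: `p` is an integral generator of `H⁴(S(ℂ); ℂ)` (the generator clause of X). Local notation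
only. -/
local notation3 (prettyPrint := false) "Gen[" S ", " p "]" =>
  (IsIntegralClass p ∧ ∀ q : complexBetti S (2 * 2), IsIntegralClass q → ∃ n : ℤ, q = n • p)

/-- `Corr[μ, S, S', hS, hS' ; γ, y] = [γ]_* y = fst_*(snd^* y ∪ γ)`, the action of
`γ ∈ H⁴((S ⊗ S′)(ℂ); ℂ)` as a correspondence `H²(S′) → H²(S)` (the FIRST factor receives). Local notation
only, verbatim from the route's Theorems files. -/
local notation3 (prettyPrint := false) "Corr[" μ ", " S ", " S' ", " hS ", " hS' " ; " γ ", " y "]" =>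
  complexGysin μ
    (IsSmoothProjective.tensor_holds (IsK3Surface.isSmoothProjective hS)
      (IsK3Surface.isSmoothProjective hS'))
    (IsK3Surface.isSmoothProjective hS) (SemiCartesianMonoidalCategory.fst S S')
    (rfl : 2 * 1 + 2 * 2 + 2 * 2 = 2 * 1 + 2 * (2 + 2))
    (cupProduct (rfl : 2 * 1 + 2 * 2 = 2 * 1 + 2 * 2)
      (complexBetti.map (SemiCartesianMonoidalCategory.snd S S') (2 * 1) y) γ)

/-- `OutAnchor[μ, S, Sg, hS, hSg, p, pg]`: an algebraic OUT-anchor `2`-similitude at `S` with partner `Sg`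
(verbatim the notation of `…HKSectorTheorem` / `…HKTargetTheorem`). Local notation only. -/
local notation3 (prettyPrint := false)
    "OutAnchor[" μ ", " S ", " Sg ", " hS ", " hSg ", " p ", " pg "]" =>
  ∃ Ψ : complexBetti S (2 * 1) ≃ₗ[ℂ] complexBetti Sg (2 * 1),
    (∀ y, IsRationalClass y → IsRationalClass (Ψ.symm y)) ∧
    (∀ (i j : ℕ) y, IsOfHodgeType 2 Sg (2 * 1) i j y →
      IsOfHodgeType 2 S (2 * 1) i j (Ψ.symm y)) ∧
    (∀ (u v : complexBetti Sg (2 * 1)) (b : ℂ),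
      cupProduct (rfl : 2 * 1 + 2 * 1 = 2 * 2) u v = ((2 : ℂ) * b) • pg →
        cupProduct (rfl : 2 * 1 + 2 * 1 = 2 * 2) (Ψ.symm u) (Ψ.symm v) = b • p) ∧
    ∃ γ ∈ algebraicClasses (MonoidalCategoryStruct.tensorObj Sg S) 2,
      ∀ x : complexBetti S (2 * 1), Ψ x = Corr[μ, Sg, S, hSg, hS ; γ, x]

/-- `AnchorData[μ, S, hS, p]`: the body of the transport crux `TwinTwistorTransport` at `S` after its
`∀ μ, PD → ∀ S hS p, Gen →` prefix — a projective K3 partner `S″`, a generator `p″` and an algebraic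
`Ψ : H²(S″) ≃ H²(S)` whose inverse is rational, type-preserving and halves the cup form (verbatim the
skeleton's notation). Local notation only. -/
local notation3 (prettyPrint := false) "AnchorData[" μ ", " S ", " hS ", " p "]" =>
  ∃ (S'' : SchemeOver ℂ) (hS'' : IsK3Surface S'') (p'' : complexBetti S'' (2 * 2)),
    Gen[S'', p''] ∧
    ∃ Ψ : complexBetti S'' (2 * 1) ≃ₗ[ℂ] complexBetti S (2 * 1),
      (∀ y, IsRationalClass y → IsRationalClass (Ψ.symm y)) ∧
      (∀ (i j : ℕ) y, IsOfHodgeType 2 S (2 * 1) i j y →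
        IsOfHodgeType 2 S'' (2 * 1) i j (Ψ.symm y)) ∧
      (∀ (u v : complexBetti S (2 * 1)) (b : ℂ),
        cupProduct (rfl : 2 * 1 + 2 * 1 = 2 * 2) u v = ((2 : ℂ) * b) • p →
          cupProduct (rfl : 2 * 1 + 2 * 1 = 2 * 2) (Ψ.symm u) (Ψ.symm v) = b • p'') ∧
      ∃ γ ∈ algebraicClasses (MonoidalCategoryStruct.tensorObj S S'') 2,
        ∀ x : complexBetti S'' (2 * 1), Ψ x = Corr[μ, S, S'', hS, hS'' ; γ, x]

/-- `OffHKSectorTransport`: the transport crux `TwinTwistorTransport` verbatim for K3 surfaces OFF the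
HK-Nikulin sector. Local notation only. -/
local notation3 (prettyPrint := false) "OffHKSectorTransport" =>
  ∀ (μ : OrientationFamily), μ.HasPoincareDuality →
    ∀ (S : SchemeOver ℂ) (hS : IsK3Surface S) (p : complexBetti S (2 * 2)), Gen[S, p] →
      ¬ InHKNikulinSector S → AnchorData[μ, S, hS, p]

/-! ## An out-anchor is a transport datum -/

/-- **An algebraic out-anchor at `S` is the transport datum of `TwinTwistorTransport` at `S`.**  Given an
out-anchor `Ψ₀ : H²(S) ⥲ H²(Σ)` (algebraic, inverse rational, type-preserving, halving), put `S″ := Σ`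
and `Ψ := 2 · Ψ₀⁻¹ : H²(Σ) ≃ H²(S)`: `Ψ₀⁻¹` is the action of an algebraic class on `S ⊗ Σ`
(`stub_inverseAnchorAlgebraic`, from `stub_topPushProportional` and `stub_corrTranspose`), so is `2 · Ψ₀⁻¹`
(`induced_smul`); and `Ψ⁻¹ = ½ · Ψ₀` is rational and type-preserving because `Ψ₀` is
(`stub_anchorForward`) and halves the cup form because `Ψ₀` doubles it (`(u.v) = 2b·p ⟹ (Ψ₀u.Ψ₀v) = 4b·p_Σ
⟹ (½Ψ₀u.½Ψ₀v) = b·p_Σ`). [cite: Varesco2023, §2 (proof of Thm. 2.1)]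
[cite: FultonYoungTableaux1997, Appendix B §B.1 (5)–(6)] -/
theorem anchorData_of_outAnchor (hmk : Huybrechts_K3_marking_exists)
    {μ : OrientationFamily} (hμ : μ.HasPoincareDuality)
    {S : SchemeOver ℂ} (hS : IsK3Surface S) {p : complexBetti S (2 * 2)} (hp : Gen[S, p])
    {Sg : SchemeOver ℂ} (hSg : IsK3Surface Sg) {pg : complexBetti Sg (2 * 2)} (hpg : Gen[Sg, pg])
    (hA : OutAnchor[μ, S, Sg, hS, hSg, p, pg]) : AnchorData[μ, S, hS, p] := by
  obtain ⟨Ψ, hΨr, hΨt, hΨs, γ, hγ, hΨγ⟩ := hA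
  obtain ⟨hΨr', hΨt', hΨs'⟩ := stub_anchorForward hmk S Sg hS hSg p pg hp hpg Ψ hΨr hΨt hΨs
  -- the inverse of the out-anchor is algebraic
  obtain ⟨γ', hγ', hΨ'⟩ := stub_inverseAnchorAlgebraic stub_topPushProportional stub_corrTranspose hmk μ
    hμ S Sg hS hSg p pg hp hpg Ψ hΨs ⟨γ, hγ, hΨγ⟩
  -- `Ψ₂ := 2 · Ψ⁻¹ : H²(Σ) ≃ H²(S)`, with inverse `½ · Ψ`
  have hhalf : (((1 / 2 : ℚ) : ℂ)) = (2 : ℂ)⁻¹ := by push_cast; ring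
  let f : complexBetti Sg (2 * 1) →ₗ[ℂ] complexBetti S (2 * 1) :=
    (2 : ℂ) • (Ψ.symm : complexBetti Sg (2 * 1) →ₗ[ℂ] complexBetti S (2 * 1))
  let g : complexBetti S (2 * 1) →ₗ[ℂ] complexBetti Sg (2 * 1) :=
    (((1 / 2 : ℚ) : ℂ)) • (Ψ : complexBetti S (2 * 1) →ₗ[ℂ] complexBetti Sg (2 * 1))
  have hfg : ∀ y, f (g y) = y := fun y => by
    simp only [f, g, LinearMap.smul_apply, LinearEquiv.coe_coe, map_smul, LinearEquiv.symm_apply_apply,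
      smul_smul, hhalf, inv_mul_cancel₀ (two_ne_zero' ℂ), one_smul]
  have hgf : ∀ x, g (f x) = x := fun x => by
    simp only [f, g, LinearMap.smul_apply, LinearEquiv.coe_coe, map_smul, LinearEquiv.apply_symm_apply,
      smul_smul, hhalf, mul_inv_cancel₀ (two_ne_zero' ℂ), one_smul]
  let Ψ₂ : complexBetti Sg (2 * 1) ≃ₗ[ℂ] complexBetti S (2 * 1) :=
    LinearEquiv.ofLinear f g (LinearMap.ext hfg) (LinearMap.ext hgf)
  have hΨ₂ : ∀ x, Ψ₂ x = ((2 : ℂ) • (Ψ.symm : complexBetti Sg (2 * 1) →ₗ[ℂ] complexBetti S (2 * 1))) x :=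
    fun x => rfl
  have hΨ₂' : ∀ y, Ψ₂.symm y = (((1 / 2 : ℚ) : ℂ)) • Ψ y := fun y => rfl
  -- algebraicity of `Ψ₂ = 2 · Ψ⁻¹`
  obtain ⟨γ₂, hγ₂, hΨγ₂⟩ := induced_smul
    (IsSmoothProjective.tensor_holds (IsK3Surface.isSmoothProjective hS)
      (IsK3Surface.isSmoothProjective hSg)) (IsK3Surface.isSmoothProjective hS)
    (rfl : 2 * 1 + 2 * 2 = 2 * 1 + 2 * 2) (rfl : 2 * 1 + 2 * 2 + 2 * 2 = 2 * 1 + 2 * (2 + 2))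
    (2 : ℂ) ⟨γ', hγ', fun u => hΨ' u⟩
  refine ⟨Sg, hSg, pg, hpg, Ψ₂, ?_, ?_, ?_, γ₂, hγ₂, fun x => ?_⟩
  · intro y hy
    rw [hΨ₂']
    exact (hΨr' y hy).smul (1 / 2 : ℚ)
  · intro i j y hy
    rw [hΨ₂']
    exact (hΨt' i j y hy).smul _
  · intro u v b huv
    rw [hΨ₂', hΨ₂']
    simp only [map_smul, LinearMap.smul_apply]
    rw [hΨs' u v ((2 : ℂ) * b) huv, smul_smul, smul_smul, hhalf]
    congr 1
    ring
  · rw [hΨ₂, hΨγ₂ x]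

/-! ## The transport crux on the HK-Nikulin sector -/

/-- **`TwinTwistorTransport` AT EVERY PROJECTIVE K3 SURFACE IN THE HK-NIKULIN SECTOR**: for `S` with
`T(S)_ℚ ↪ (U³ ⊕ E₈(−2) ⊕ ⟨−2⟩)_ℚ` there are a projective K3 `S″`, a generator `p″` of `H⁴(S″)` and an
ALGEBRAIC `Ψ : H²(S″) ≃ H²(S)` whose inverse is rational, type-preserving and halves the cup form — the
out-anchor of the line (`outAnchor_onHKSector`: fixed K3 of a symplectic involution on a `K3^{[2]}`-type
fourfold realising `T(S)_ℚ`, Markman's algebraic rational Hodge isometry, the Hilbert-square incidence,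
divisor corrections and Witt completion) read as a transport datum (`anchorData_of_outAnchor`).  Granted
the named facts (markings, F1–F4), `CupProductAlgebraic` (stmt-HodgeConjecture-14350) and the two `(1,1)`
items; NO Buskin. [cite: CamereEtAl2026, Thm. 1.2 and Thm. 5.12] [cite: Markman2024, Thm. 1.1]
[cite: Varesco2023, §2 and Prop. 2.5] -/
theorem twinTwistorTransport_onHKSector
    (h₀ : (Huybrechts_K3_marking_exists ∧ CamereEtAl2026_symplecticInvolution_periodSurjective ∧
        CamereEtAl2023_fixedK3_restriction ∧ Markman2024_rationalHodgeIsometry_algebraic_marked ∧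
        Beauville1983_hilbertSquare_markedIncidence))
    (hC : Summit.HodgeConjecture.HodgeConjecture.Theses.EndoscopicMiddleDegree.CupProductAlgebraic)
    (hL : LefschetzOneOneK3) (hN : AlgebraicClassesOneOneK3) {μ : OrientationFamily}
    (hμ : μ.HasPoincareDuality) {S : SchemeOver ℂ} (hS : IsK3Surface S) {p : complexBetti S (2 * 2)}
    (hp : Gen[S, p]) (hsec : InHKNikulinSector S) : AnchorData[μ, S, hS, p] := by
  obtain ⟨Sg, hSg, pg, hpg, hA⟩ := outAnchor_onHKSector h₀ hC hL hN hμ hS hp hsec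
  exact anchorData_of_outAnchor h₀.1 hμ hS hp hSg hpg hA

/-- **`TwinTwistorTransport` on the HK-Nikulin sector from named published facts only** (markings, F1–F4,
Voisin I Thm. 11.32 ⊗ ℂ for the cup-product item 14350; `AlgebraicClassesOneOneK3` by its proof) plus
`LefschetzOneOneK3` (13678). [cite: CamereEtAl2026, Thm. 1.2 and Thm. 5.12] [cite: Markman2024, Thm. 1.1]
[cite: VoisinHodgeI2002, Thm. 11.32] -/
theorem twinTwistorTransport_onHKSector_of_namedFacts
    (h₀ : (Huybrechts_K3_marking_exists ∧ CamereEtAl2026_symplecticInvolution_periodSurjective ∧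
        CamereEtAl2023_fixedK3_restriction ∧ Markman2024_rationalHodgeIsometry_algebraic_marked ∧
        Beauville1983_hilbertSquare_markedIncidence))
    (hV : span_holomorphicBundleChernCharacter_eq_algebraicClasses) (hL : LefschetzOneOneK3)
    {μ : OrientationFamily} (hμ : μ.HasPoincareDuality) {S : SchemeOver ℂ} (hS : IsK3Surface S)
    {p : complexBetti S (2 * 2)} (hp : Gen[S, p]) (hsec : InHKNikulinSector S) :
    AnchorData[μ, S, hS, p] :=
  twinTwistorTransport_onHKSector h₀ (cupProductAlgebraic_of_chernCharacterSpan hV) hL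
    algebraicClassesOneOneK3_proof hμ hS hp hsec

/-- **The transport crux reduces to K3 surfaces off the HK-Nikulin sector**: granted the named facts and
`LefschetzOneOneK3`, `TwinTwistorTransport` (stmt-HodgeConjecture-14393) follows from its restriction to
projective K3 surfaces `S` with `T(S)_ℚ ↪̸ (U³ ⊕ E₈(−2) ⊕ ⟨−2⟩)_ℚ` (rank `T ≥ 15`, i.e. `ρ ≤ 7`, and the
Hasse-obstructed rational types of rank 13/14) — the locus where no algebraic `2`-anchor is known
(maximal real-multiplication families included). [cite: VanGeemenSchuett2023, Thm. 3.10 and Rem. 4.9]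
[cite: Varesco2023, Thm. 2.1 and Prop. 2.5] -/
theorem twinTwistorTransport_of_offHKSectorTransport
    (h₀ : (Huybrechts_K3_marking_exists ∧ CamereEtAl2026_symplecticInvolution_periodSurjective ∧
        CamereEtAl2023_fixedK3_restriction ∧ Markman2024_rationalHodgeIsometry_algebraic_marked ∧
        Beauville1983_hilbertSquare_markedIncidence))
    (hV : span_holomorphicBundleChernCharacter_eq_algebraicClasses) (hL : LefschetzOneOneK3)
    (hoff : OffHKSectorTransport) : TwinTwistorTransport := by
  intro μ hμ S hS p hp
  by_cases hsec : InHKNikulinSector S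
  · exact twinTwistorTransport_onHKSector_of_namedFacts h₀ hV hL hμ hS hp hsec
  · exact hoff μ hμ S hS p hp hsec

/-- Registered anchor of this file: closed form of `twinTwistorTransport_of_offHKSectorTransport` — the
transport crux from the named facts (markings, F1–F4, Voisin I 11.32 ⊗ ℂ), `LefschetzOneOneK3` (13678) and
its own restriction to K3 surfaces off the HK-Nikulin sector. [cite: Varesco2023, Thm. 2.1 and Prop. 2.5]
[cite: CamereEtAl2026, Thm. 1.2] [cite: VoisinHodgeI2002, Thm. 11.32] -/
theorem hkTwistorTransportOnSector_anchor :
    (Huybrechts_K3_marking_exists ∧ CamereEtAl2026_symplecticInvolution_periodSurjective ∧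
        CamereEtAl2023_fixedK3_restriction ∧ Markman2024_rationalHodgeIsometry_algebraic_marked ∧
        Beauville1983_hilbertSquare_markedIncidence) →
    span_holomorphicBundleChernCharacter_eq_algebraicClasses →
    LefschetzOneOneK3 → OffHKSectorTransport →
    Summit.HodgeConjecture.HodgeConjecture.Theses.NikulinTwinTransport.TwinTwistorTransport :=
  fun h₀ hV hL hoff => twinTwistorTransport_of_offHKSectorTransport h₀ hV hL hoff

end Summit.HodgeConjecture.HodgeConjecture.Theorems.NikulinTwinTransport

end
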